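import Mathlib.Algebra.Polynomial.Bivariate
import Literature.NumberTheory.DiophantineGeometry.FunctionFieldHasseWeilProofs
import Literature.NumberTheory.DiophantineGeometry.FunctionFieldSchmidtDegreeOneConsequencesProofs
import Literature.NumberTheory.DiophantineGeometry.FunctionFieldZetaProofs
import HarnessLib

/-!
# Rational places of a plane model from the Hasse–Weil theorem

Library file continuing the function-field chain (`FunctionFieldDivisors` … `FunctionFieldHasseWeilProofs`).
For an algebraic function field `F/𝔽_q` of one variable with full constant field `𝔽_q` and genus `g`
it extracts from the Hasse–Weil theorem (`hasseWeil_holds`, Stichtenoth Thm. 5.2.1) the classical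
lower bound for the number `N = N_1 = B_1` of rational places,

* `le_numPlacesOfDegree_one`: `q + 1 - 2g√q ≤ N` (Stichtenoth Thm. 5.2.3, the Hasse–Weil bound),

and turns it into the existence of *finite* rational places of a plane model: if `x ∈ F` has pole
divisor of degree `deg (x)_∞ < q + 1 - 2g√q` then some rational place `P` has `x ∈ O_P`
(`exists_degree_eq_one_and_mem`, since the rational poles of `x` are at most `deg (x)_∞` in number),
and if moreover `y ∈ ℒ((x)_∞)` then also `y ∈ O_P`, so that the residues `(a, b) ∈ 𝔽_q²` of
`(x, y)` at `P` form an `𝔽_q`-rational zero of every `Φ ∈ 𝔽_q[X][Y]` with `Φ(x, y) = 0`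
(`exists_evalEval_eq_zero_of_lt`). This is the place-theoretic half of the argument "Weil's
estimate shows that an absolutely irreducible plane curve has a rational point for `q` large"
(Cafure–Matera 2006, proof of Thm. 5.4); the genus bound `2g ≤ (d-1)(d-2)` is
`PlaneCurveGenusBoundProofs`, and the function field of a plane curve is constructed elsewhere.

## References

* H. Stichtenoth, *Algebraic Function Fields and Codes*, 2nd ed., GTM 254, Springer 2009,
  Def. 1.1.14, Thm. 1.4.11, Cor. 5.1.16, Thm. 5.2.1, Thm. 5.2.3. [Stichtenoth2009]
* A. Cafure, G. Matera, *Improved explicit estimates on the number of solutions of equations over a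
  finite field*, Finite Fields Appl. 12 (2006) 155–185, proof of Thm. 5.4. [CafureMatera2006]
-/

noncomputable section

open scoped Classical Polynomial.Bivariate
open Polynomial

namespace Literature.NumberTheory.DiophantineGeometry.AlgFunctionField

universe u v

variable {K : Type u} {F : Type v} [Field K] [Field F] [Algebra K F]

/-! ### Evaluation of `Φ ∈ K[X][Y]` along ring homomorphisms -/

/-- Transport of the value `Φ(a, b)` of `Φ ∈ K[X][Y]` (base-changed along `f : K → A`) under a
ring homomorphism `g : A → B`. [folklore] -/
theorem map_evalEval_map_mapRingHom {A B : Type*} [CommSemiring A] [CommSemiring B]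
    (f : K →+* A) (g : A →+* B) (Φ : K[X][Y]) (a b : A) :
    g ((Φ.map (mapRingHom f)).evalEval a b) =
      (Φ.map (mapRingHom (g.comp f))).evalEval (g a) (g b) := by
  rw [← map_mapRingHom_evalEval, Polynomial.map_map]
  congr 2
  ext <;> simp

/-! ### Residues at a rational place -/

namespace PlaceOver

/-- At a place of degree one the residue field is `K`: the structure map `K → F_P` is surjective
(Stichtenoth Def. 1.1.14: `deg P = [F_P : K] = 1`). [cite: Stichtenoth2009, Def. 1.1.14] -/
theorem algebraMap_residueField_surjective_of_degree_eq_one (P : PlaceOver K F)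
    (hP : P.degree = 1) : Function.Surjective (algebraMap K P.residueField) := by
  haveI : FiniteDimensional K P.residueField := Module.finite_of_finrank_pos (by
    change 0 < P.degree; omega)
  intro w
  have h1 : Module.finrank K P.residueField = 1 := hP
  obtain ⟨c, hc⟩ := (finrank_eq_one_iff_of_nonzero' (1 : P.residueField) one_ne_zero).1 h1 w
  exact ⟨c, by rw [Algebra.algebraMap_eq_smul_one, hc]⟩

/-- **The centre of a rational place is a rational point.** If `P` is a place of degree one of
`F/K`, `x, y ∈ O_P`, and `Φ ∈ K[X][Y]` satisfies `Φ(x, y) = 0` in `F`, then the residues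
`(a, b) ∈ K²` of `(x, y)` satisfy `Φ(a, b) = 0` (the residue map `O_P → F_P = K` is a ring
homomorphism fixing `K`). [folklore] -/
theorem exists_evalEval_eq_zero_of_mem (P : PlaceOver K F) (hP : P.degree = 1) {x y : F}
    (hx : x ∈ P.toValuationSubring) (hy : y ∈ P.toValuationSubring) {Φ : K[X][Y]}
    (hΦ : (Φ.map (mapRingHom (algebraMap K F))).evalEval x y = 0) :
    ∃ a b : K, Φ.evalEval a b = 0 := by
  set O := P.toValuationSubring with hO
  obtain ⟨a, ha⟩ := P.algebraMap_residueField_surjective_of_degree_eq_one hP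
    (IsLocalRing.residue O ⟨x, hx⟩)
  obtain ⟨b, hb⟩ := P.algebraMap_residueField_surjective_of_degree_eq_one hP
    (IsLocalRing.residue O ⟨y, hy⟩)
  refine ⟨a, b, ?_⟩
  -- `Φ(x, y)` computed inside `O_P` vanishes
  have hO0 : (Φ.map (mapRingHom (algebraMap K O))).evalEval ⟨x, hx⟩ ⟨y, hy⟩ = 0 := by
    have hinj : Function.Injective (algebraMap O F) := fun u v h ↦ Subtype.ext h
    apply hinj
    rw [map_evalEval_map_mapRingHom, map_zero, ← IsScalarTower.algebraMap_eq K O F]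
    exact hΦ
  -- apply the residue map
  have hres := congrArg (IsLocalRing.residue O) hO0
  rw [map_evalEval_map_mapRingHom, map_zero] at hres
  have hcomp : (IsLocalRing.residue O).comp (algebraMap K O) = algebraMap K P.residueField :=
    RingHom.ext fun c ↦ (P.algebraMap_residueField_apply c).symm
  rw [hcomp, ← ha, ← hb, map_mapRingHom_evalEval] at hres
  exact (algebraMap K P.residueField).injective (by rw [hres, map_zero])

end PlaceOver

/-! ### Poles and the pole divisor -/

/-- For an effective divisor `A ≥ 0` of a function field of one variable, the number of places
in its support is at most `deg A` (each place has degree `≥ 1`). [folklore] -/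
theorem card_support_le_degree [IsAlgFunctionField K F] {A : Divisor K F} (hA : 0 ≤ A) :
    (A.support.card : ℤ) ≤ A.degree := by
  rw [Divisor.degree_apply, Finsupp.sum]
  have : ∀ v ∈ A.support, (1 : ℤ) ≤ A v * (v.degree : ℤ) := fun v hv ↦ by
    have h1 : 1 ≤ A v := by
      have := Finsupp.mem_support_iff.1 hv
      have h0 : 0 ≤ A v := hA v
      omega
    have h2 : (1 : ℤ) ≤ v.degree := by exact_mod_cast v.one_le_degree
    nlinarith
  calc (A.support.card : ℤ) = ∑ v ∈ A.support, (1 : ℤ) := by simp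
    _ ≤ ∑ v ∈ A.support, A v * (v.degree : ℤ) := Finset.sum_le_sum this

/-- A pole of `x ≠ 0` lies in the support of the pole divisor `(x)_∞ = (x)⁻`. [folklore] -/
theorem mem_support_negPart_principalDivisor [IsAlgFunctionField K F] {x : F} (hx : x ≠ 0)
    {v : PlaceOver K F} (hv : x ∉ v.toValuationSubring) :
    v ∈ ((principalDivisor K x)⁻).support := by
  rw [Finsupp.mem_support_iff, Divisor.negPart_apply, principalDivisor_apply_of_ne_zero hx]
  rw [v.mem_toValuationSubring_iff_ord_nonneg hx] at hv
  have : max (-v.ord x) 0 = -v.ord x := max_eq_left (by omega)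
  omega

/-- If `y ∈ ℒ((x)_∞)` then `y` is regular wherever `x` is: `x ∈ O_P ⇒ y ∈ O_P`. [folklore] -/
theorem mem_of_mem_riemannRochSpace_negPart [IsAlgFunctionField K F] {x y : F} (hx : x ≠ 0)
    (hy : y ∈ riemannRochSpace (principalDivisor K x)⁻) {v : PlaceOver K F}
    (hv : x ∈ v.toValuationSubring) : y ∈ v.toValuationSubring := by
  by_cases hy0 : y = 0
  · rw [hy0]; exact zero_mem _
  have h := (mem_riemannRochSpace_iff_neg_le_ord _ hy0).1 hy v
  rw [Divisor.negPart_apply, principalDivisor_apply_of_ne_zero hx] at h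
  rw [v.mem_toValuationSubring_iff_ord_nonneg hx] at hv
  rw [v.mem_toValuationSubring_iff_ord_nonneg hy0]
  have : max (-v.ord x) 0 = 0 := max_eq_right (by omega)
  omega

/-! ### The Hasse–Weil lower bound for the number of rational places -/

/-- `N_1 = B_1`: the point count in degree one is the number of rational places
(Stichtenoth eq. (5.40) at `r = 1`). [cite: Stichtenoth2009, eq. (5.40)] -/
theorem pointCount_one : pointCount K F 1 = numPlacesOfDegree K F 1 := by
  simp [pointCount]

section Finite

variable [Fintype K] [IsAlgFunctionField K F] [IsIntegrallyClosedIn K F]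

/-- **The Hasse–Weil bound (Stichtenoth Thm. 5.2.3), lower half:** the number `N` of rational
places of a function field `F/𝔽_q` with full constant field `𝔽_q` and genus `g` satisfies
`q + 1 - 2g√q ≤ N`. From `N = q + 1 - ∑_{i=1}^{2g} αᵢ` (Cor. 5.1.16) with `|αᵢ| = √q`
(Thm. 5.2.1, `hasseWeil_holds`). [cite: Stichtenoth2009, Thm. 5.2.3] -/
theorem le_numPlacesOfDegree_one :
    (Fintype.card K : ℝ) + 1 - 2 * genus K F * √(Fintype.card K : ℝ) ≤
      numPlacesOfDegree K F 1 := by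
  obtain ⟨α, hα, hN⟩ := exists_pointCount_eq_of_facts (K := K) (F := F)
    lSeries_eq_polynomial_holds hasseWeil_holds
  have h1 := congrArg Complex.re (hN 1 one_pos)
  rw [pointCount_one] at h1
  simp only [pow_one, Complex.natCast_re, Complex.sub_re, Complex.add_re, Complex.one_re,
    Complex.re_sum] at h1
  have hre : ∀ i, (α i).re ≤ √(Fintype.card K : ℝ) := fun i ↦
    (Complex.re_le_norm (α i)).trans (hα i).le
  have hsum : ∑ i, (α i).re ≤ 2 * genus K F * √(Fintype.card K : ℝ) := by
    calc ∑ i, (α i).re ≤ ∑ _i : Fin (2 * genus K F), √(Fintype.card K : ℝ) :=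
          Finset.sum_le_sum fun i _ ↦ hre i
      _ = 2 * genus K F * √(Fintype.card K : ℝ) := by simp
  rw [h1]
  linarith

/-- **Finite rational places of a plane model.** If `x ≠ 0` has `deg (x)_∞ < q + 1 - 2g√q`, then
there is a rational place `P` of `F/𝔽_q` with `x ∈ O_P`: the rational places number at least
`q + 1 - 2g√q` (Hasse–Weil) and those that are poles of `x` at most `deg (x)_∞`.
[cite: Stichtenoth2009, Thm. 5.2.3 and Thm. 1.4.11] -/
theorem exists_degree_eq_one_and_mem {x : F} (hx : x ≠ 0)
    (hlt : ((Divisor.degree (principalDivisor K x)⁻ : ℤ) : ℝ) <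
      (Fintype.card K : ℝ) + 1 - 2 * genus K F * √(Fintype.card K : ℝ)) :
    ∃ P : PlaceOver K F, P.degree = 1 ∧ x ∈ P.toValuationSubring := by
  by_contra hcon
  push Not at hcon
  set S := (finite_setOf_degree_eq (K := K) (F := F) 1).toFinset with hS
  have hScard : S.card = numPlacesOfDegree K F 1 := (numPlacesOfDegree_eq_card (K := K) (F := F) 1).symm
  have hsub : S ⊆ ((principalDivisor K x)⁻).support := fun P hP ↦ by
    rw [hS, Set.Finite.mem_toFinset, Set.mem_setOf_eq] at hP
    exact mem_support_negPart_principalDivisor hx (hcon P hP)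
  have h1 : (numPlacesOfDegree K F 1 : ℤ) ≤ Divisor.degree (principalDivisor K x)⁻ := by
    rw [← hScard]
    exact (Nat.cast_le.2 (Finset.card_le_card hsub)).trans
      (card_support_le_degree (negPart_nonneg _))
  have h2 : (numPlacesOfDegree K F 1 : ℝ) ≤ ((Divisor.degree (principalDivisor K x)⁻ : ℤ) : ℝ) := by
    exact_mod_cast h1
  have h3 := le_numPlacesOfDegree_one (K := K) (F := F)
  linarith

/-- **Rational points of a plane model from the Hasse–Weil bound.** Let `F/𝔽_q` have full constant
field `𝔽_q` and genus `g`, let `x ≠ 0` with `deg (x)_∞ < q + 1 - 2g√q`, `y ∈ ℒ((x)_∞)`, and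
`Φ ∈ 𝔽_q[X][Y]` with `Φ(x, y) = 0`. Then `Φ` has an `𝔽_q`-rational zero: the residues of `(x, y)`
at a rational place `P` with `x ∈ O_P` (hence `y ∈ O_P`). This is how Weil's estimate yields
rational points in Cafure–Matera's proof of Thm. 5.4. [cite: CafureMatera2006, proof of Thm. 5.4]
[cite: Stichtenoth2009, Thm. 5.2.3] -/
theorem exists_evalEval_eq_zero_of_lt {x y : F} (hx : x ≠ 0)
    (hlt : ((Divisor.degree (principalDivisor K x)⁻ : ℤ) : ℝ) <
      (Fintype.card K : ℝ) + 1 - 2 * genus K F * √(Fintype.card K : ℝ))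
    (hy : y ∈ riemannRochSpace (principalDivisor K x)⁻) {Φ : K[X][Y]}
    (hΦ : (Φ.map (mapRingHom (algebraMap K F))).evalEval x y = 0) :
    ∃ a b : K, Φ.evalEval a b = 0 := by
  obtain ⟨P, hP, hxP⟩ := exists_degree_eq_one_and_mem hx hlt
  exact P.exists_evalEval_eq_zero_of_mem hP hxP
    (mem_of_mem_riemannRochSpace_negPart hx hy hxP) hΦ

end Finite

end Literature.NumberTheory.DiophantineGeometry.AlgFunctionField
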